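import Summits.HubbardSuperconductivity.HubbardSuperconductivity.Theses.LevyLogBootstrap
import Literature.Analysis.Matrix.SchoenbergKernels
import HarnessLib

/-!
# Sketch — crux-ideate (ideator 2) for `Block2InfDivXXZ` (stmt-HubbardSuperconductivity-15048)

First lemmas of the idea cards, stated over existing declarations (not proved here).

* `HadamardDePrilDomination` — card `depril-condensate-domination`: the compound-Poisson
  (Katti / De Pril / Panjer) criterion in Hadamard-matrix form.
* `lswY`, `lswPhi`, `lswBlockKernel`, `gsBlockKernel`, `cosTransform`, `LSWSandwichTransfer` —
  card `spinwave-levy-reference-sandwich`: the transfer target C⁺ (a LINEAR two-sided, mode-by-mode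
  sandwich of the coarse transverse structure factor around the 2×2-blocked linear-spin-wave law
  implies negative type of `-log K₂`, i.e. `stub_blockLogNegType` of the birth line).
* `SectorGroundIsGlobal` — card `loop-connectivity-transfer`: the half-filled sector carries the
  global ground-state energy (needed to read Ueltschi's Gibbs-state loop identity at β → ∞ in the
  `S^z_tot = 0` sector).
-/

noncomputable section

set_option linter.dupNamespace false

namespace Summit.HubbardSuperconductivity.HubbardSuperconductivity.Cruxes.Block2InfDivXXZ.Ideate2

open Matrix Finset
open Literature.Probability.LatticeModels Literature.MathematicalPhysics.QuantumLattice
open Literature.Analysis.Matrix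
open scoped BigOperators

/-- **Hadamard–De Pril domination** (card A, first lemma; provable now).  If `A` is a real
positive semidefinite matrix with entries in `(-1, 1)` whose Hadamard powers are dominated
geometrically, `A^{∘(m+1)} ≼ θ A^{∘m}` for all `m ≥ 1` with `θ < 1`, then
`log(1 + A_ij) = Σ (-1)^{m+1} A^{∘m}_ij / m` is positive semidefinite (pair consecutive terms;
Schur product theorem), hence for every `c > 0` the kernel `-log (c (1 + A_ij))` is negative
definite — i.e. `c (1 + A)` is infinitely divisible.  In the translation-invariant case the
hypothesis for `m = 1` ("two-phonon domination" `(r*r) ≤ θ r` on the momentum group) implies it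
for all `m`. Katti (1967); Sundt (1999); Steutel–van Harn (2004) Ch. II; Horn (1969). -/
def HadamardDePrilDomination : Prop :=
  ∀ (n : Type) [Fintype n] [DecidableEq n] (A : Matrix n n ℝ) (c θ : ℝ),
    0 < c → 0 ≤ θ → θ < 1 → A.PosSemidef → (∀ i j, |A i j| < 1) →
    (∀ m : ℕ, 1 ≤ m →
      (θ • Matrix.of (fun i j => A i j ^ m) - Matrix.of (fun i j => A i j ^ (m + 1))).PosSemidef) →
    IsNegDefKernel fun i j => -Real.log (c * (1 + A i j))

/-- Linear-spin-wave Lévy density of the ferro-XY/AF-Ising `S = ½` XXZ model at anisotropy `Δ`: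
`Y(q) = √((1 - Δ γ_q)/(1 - γ_q))`, `γ_q = (cos q₁ + cos q₂)/2`, `q = 2πk/M`; `Y(0) := 0`
(the zero mode is the condensate).  Its only zero on `Δ ∈ [-1,0]` is `q = (π,π)` at `Δ = -1`. -/
def lswY (M : ℕ) [NeZero M] (Δ : ℝ) (k : TorusSite 2 M) : ℝ :=
  if (∀ i : Fin 2, k i = 0) then 0 else
    Real.sqrt ((1 - Δ * ((Real.cos (2 * Real.pi * ((k 0).val : ℝ) / M) +
        Real.cos (2 * Real.pi * ((k 1).val : ℝ) / M)) / 2)) /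
      (1 - (Real.cos (2 * Real.pi * ((k 0).val : ℝ) / M) +
        Real.cos (2 * Real.pi * ((k 1).val : ℝ) / M)) / 2))

/-- The phase `q·X = 2π (k₁X₁ + k₂X₂)/M` on the torus `(ℤ/M)²`. -/
def torusPhase (M : ℕ) [NeZero M] (k X : TorusSite 2 M) : ℝ :=
  2 * Real.pi * (((k 0).val : ℝ) * ((X 0).val : ℝ) + ((k 1).val : ℝ) * ((X 1).val : ℝ)) / M

/-- Spin-wave log-coherence `φ_LSW(X) = M⁻² Σ_q Y(q) (1 - cos q·X)` (manifestly of negative type: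
nonnegative Lévy coefficients `Y(q)/M²`). -/
def lswPhi (M : ℕ) [NeZero M] (Δ : ℝ) (X : TorusSite 2 M) : ℝ :=
  (∑ k : TorusSite 2 M, lswY M Δ k * (1 - Real.cos (torusPhase M k X))) / ((M : ℝ) ^ 2)

/-- The 2×2-BLOCKED spin-wave reference kernel, fine-indexed exactly like the crux's `K₂`:
`K_ref(x,y) = Σ_{x' ∈ block x, y' ∈ block y} exp(-φ_LSW(y' - x'))`. -/
def lswBlockKernel (M : ℕ) [NeZero M] (Δ : ℝ) (x y : TorusSite 2 M) : ℝ :=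
  ∑ x' : TorusSite 2 M, ∑ y' : TorusSite 2 M,
    if (∀ i : Fin 2, (x' i).val / 2 = (x i).val / 2) ∧ (∀ i : Fin 2, (y' i).val / 2 = (y i).val / 2)
    then Real.exp (-(lswPhi M Δ (y' - x'))) else 0

/-- The crux's 2×2-block transverse kernel of a state `ψ`, as a function (verbatim block sum). -/
def gsBlockKernel (M : ℕ) [NeZero M] (ψ : TensorIndex (TorusSite 2 M) 2 → ℂ) (x y : TorusSite 2 M) : ℝ :=
  ∑ x' : TorusSite 2 M, ∑ y' : TorusSite 2 M,
    if (∀ i : Fin 2, (x' i).val / 2 = (x i).val / 2) ∧ (∀ i : Fin 2, (y' i).val / 2 = (y i).val / 2)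
    then (star ψ ⬝ᵥ Matrix.mulVec (onSite x' (spinRaise 1) * onSite y' (spinLower 1)) ψ).re else 0

/-- Cosine transform `Ŝ(k) = Σ_{x,y} K(x,y) cos(q·(y-x))` of a kernel on the fine torus.  For a
fine-indexed BLOCK kernel and `k` with `kᵢ < M/2` it equals the coarse structure factor at coarse
momentum `k` times the positive form factor `16 cos²(πk₁/M) cos²(πk₂/M) · (M/2)²`, which cancels in
relative (sandwich) comparisons of two block kernels. -/
def cosTransform (M : ℕ) [NeZero M] (K : TorusSite 2 M → TorusSite 2 M → ℝ) (k : TorusSite 2 M) : ℝ :=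
  ∑ x : TorusSite 2 M, ∑ y : TorusSite 2 M, K x y * Real.cos (torusPhase M k (y - x))

/-- **Transfer target C⁺ of card B (`spinwave-levy-reference-sandwich`).**  There is a universal
tolerance `c > 0` such that: whenever the coarse transverse structure factor of a half-filled
sector ground state lies, MODE BY MODE at every nonzero coarse momentum, within relative error `c`
of a positive multiple of the blocked spin-wave law, the block kernel is of negative type in
logarithm (= `stub_blockLogNegType`, hence the crux via the landed Schoenberg seam).  No condition
at `k = 0` (the condensate) is imposed. -/
def LSWSandwichTransfer : Prop :=
  ∃ c : ℝ, 0 < c ∧ ∀ (M : ℕ) [NeZero M], Even M → 4 ≤ M → ∀ Δ ∈ Set.Icc (-1:ℝ) 0,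
    ∀ (ψ : TensorIndex (TorusSite 2 M) 2 → ℂ),
      ψ ∈ spinZSector (Λ := TorusSite 2 M) 1 0 → star ψ ⬝ᵥ ψ = 1 →
      Matrix.mulVec (xxzHamiltonian 1 (torusGraph 2 M) (-1) Δ) ψ =
        ((lowestEnergyInSector 1 (xxzHamiltonian 1 (torusGraph 2 M) (-1) Δ) 0 : ℝ) : ℂ) • ψ →
      (∃ lam : ℝ, 0 < lam ∧ ∀ k : TorusSite 2 M, (∀ i : Fin 2, (k i).val < M / 2) →
          ¬ (∀ i : Fin 2, k i = 0) →
          |cosTransform M (gsBlockKernel M ψ) k - lam * cosTransform M (lswBlockKernel M Δ) k| ≤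
            c * lam * cosTransform M (lswBlockKernel M Δ) k) →
      IsNegDefKernel fun x y : TorusSite 2 M => -Real.log (gsBlockKernel M ψ x y)

/-- **Condensate-conditioned form of the transfer (the version the numerics support).**  For every
condensate floor `t > 0` there is a tolerance `c(t) > 0`: if, besides the mode-by-mode sandwich at
`k ≠ 0`, the zero mode satisfies the ONE-SIDED bound `Ŝ₂(0) ≥ t · λ · Ŝ_ref(0)` (an order input: on a
KLS window it comes from the sum rule itself, elsewhere from `HalfFilledOrder` / the two-way continuity),
then `-log K₂` is of negative type.  (j025053: c(1) ≈ 0.5–0.7, c(0.4) ≈ 0.4, c(0.25) ≈ 0.25 for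
IR slack +50 %.) -/
def LSWSandwichTransferF : Prop :=
  ∀ t : ℝ, 0 < t → ∃ c : ℝ, 0 < c ∧ ∀ (M : ℕ) [NeZero M], Even M → 4 ≤ M → ∀ Δ ∈ Set.Icc (-1:ℝ) 0,
    ∀ (ψ : TensorIndex (TorusSite 2 M) 2 → ℂ),
      ψ ∈ spinZSector (Λ := TorusSite 2 M) 1 0 → star ψ ⬝ᵥ ψ = 1 →
      Matrix.mulVec (xxzHamiltonian 1 (torusGraph 2 M) (-1) Δ) ψ =
        ((lowestEnergyInSector 1 (xxzHamiltonian 1 (torusGraph 2 M) (-1) Δ) 0 : ℝ) : ℂ) • ψ →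
      (∃ lam : ℝ, 0 < lam ∧
        t * lam * cosTransform M (lswBlockKernel M Δ) 0 ≤ cosTransform M (gsBlockKernel M ψ) 0 ∧
        ∀ k : TorusSite 2 M, (∀ i : Fin 2, (k i).val < M / 2) → ¬ (∀ i : Fin 2, k i = 0) →
          |cosTransform M (gsBlockKernel M ψ) k - lam * cosTransform M (lswBlockKernel M Δ) k| ≤
            c * lam * cosTransform M (lswBlockKernel M Δ) k) →
      IsNegDefKernel fun x y : TorusSite 2 M => -Real.log (gsBlockKernel M ψ x y)

/-- **Blocked spin-wave law is infinitely divisible with an `M`-uniform Lévy floor** (card B,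
support; certified numerics up to `M = 64` give the floor `≈ 0.32/(M/2)²` at coarse `(π,π)`,
uniformly in `Δ ∈ [-1,0]`): stated as negative type of `-log K_ref`. -/
def LSWBlockReferenceID : Prop :=
  ∀ (M : ℕ) [NeZero M], Even M → 4 ≤ M → ∀ Δ ∈ Set.Icc (-1:ℝ) 0,
    IsNegDefKernel fun x y : TorusSite 2 M => -Real.log (lswBlockKernel M Δ x y)

/-- **Half filling carries the global ground-state energy** (card C, first lemma): for the
ferro-XY/AF-Ising torus model on `Δ ∈ [-1, 0]` the `S^z_tot = 0` sector energy is minimal among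
all magnetisation sectors `m ∈ {-M²/2, …, M²/2}` (Lieb–Mattis-type ordering without `SU(2)`;
needed to read Gibbs-state loop identities at `β → ∞` inside the sector). -/
def SectorGroundIsGlobal : Prop :=
  ∀ (M : ℕ) [NeZero M], Even M → 4 ≤ M → ∀ Δ ∈ Set.Icc (-1:ℝ) 0, ∀ m : ℤ, |m| ≤ (M : ℤ) ^ 2 / 2 →
    lowestEnergyInSector 1 (xxzHamiltonian 1 (torusGraph 2 M) (-1) Δ) 0 ≤
      lowestEnergyInSector 1 (xxzHamiltonian 1 (torusGraph 2 M) (-1) Δ) (m : ℝ)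

end Summit.HubbardSuperconductivity.HubbardSuperconductivity.Cruxes.Block2InfDivXXZ.Ideate2

end
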